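import Mathlib
import HarnessLib

/-!
# The CVaR objective of variational quantum optimization (Barkoutsos et al. 2020)

HONEST FRAMING: instance-level adjudication of specific advantage claims; no claim about
BQP vs BPP or the summit.

[cite: BarkoutsosEtAl2020, §4] (P. Kl. Barkoutsos, G. Nannicini, A. Robert, I. Tavernelli,
S. Woerner, *Improving Variational Quantum Optimization using CVaR*, Quantum 4, 256 (2020)
= arXiv:1907.04769) replaces the sample mean of the measured energies in VQE / QAOA by the
Conditional Value-at-Risk of the lower tail.  Verbatim (§4):

> "Formally, the CVaR of a random variable `X` for a confidence level `α ∈ (0, 1]` is defined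
> as `CVaR_α(X) = 𝔼[X | X ≤ F_X⁻¹(α)]` where `F_X` denotes the cumulative density function of
> `X`. In other words, CVaR is the expected value of the lower `α`-tail of the distribution of
> `X`. Without loss of generality, assume that the samples `H_k` are sorted in nondecreasing
> order, i.e. `H_{k+1} ≥ H_k`. Then, for a given set of samples `{H_k}_{k=1,…,K}` and value of
> `α`, the `CVaR_α` is defined as `(1/⌈αK⌉) ∑_{k}^{⌈αK⌉} H_k`.  Note that the limit `α ↘ 0`
> corresponds to the minimum, and `α = 1` corresponds to the expected value of `X`. In this
> sense, CVaR is a generalization of both the sample mean and the best observed sample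
> `min {H_1, …, H_K}`."

and, in the proof of Proposition 5.1 (§5), the two-qubit example

> "Consider a two-qubit Hamiltonian `H = diag(0,1,1,2)` … the quantum state constructed by
> this variational form is `|ψ(θ)⟩ = (1/√2)(cos θ/2, sin θ/2, −sin θ/2, cos θ/2)`. Given the
> Hamiltonian, we have `CVaR_1(X(θ)) = 𝔼[X(θ)] = cos² θ/2 + sin² θ/2 = 1` independent of `θ`
> … with `α = 0.5` doing the calculations shows that `CVaR_{0.5}(X(θ)) = sin² θ/2`."

This file formalizes the SAMPLE objective exactly as printed — the quantity every
"CVaR-VQE / CVaR-QAOA" row of the register reports from `K` shots — for a nondecreasing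
sequence of samples `H : ℕ → ℝ` (only the first `K` values are used):

* `tailCount α K = ⌈αK⌉`, `lowerTailMean H m = (1/m) ∑_{k<m} H_k`,
  `sampleCVaR H K α = lowerTailMean H ⌈αK⌉`;
* `sampleCVaR_one` — "`α = 1` corresponds to the expected value" (the sample mean);
* `sampleCVaR_eq_head` — "the limit `α ↘ 0` corresponds to the minimum": as soon as
  `0 < αK ≤ 1` the objective IS the first (smallest) sample, and `head_le_sample` records that
  for a sorted sequence the first sample is the minimum;
* `sampleCVaR_mono` — a consequence proved here, not a printed display: the lower-tail mean
  of a sorted sequence is nondecreasing in the number of retained samples (private helper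
  `lowerTailMean_mono`), hence `CVaR_α` is nondecreasing in `α` — the printed "generalization
  of both" sentence made quantitative — with the corollaries `head_le_sampleCVaR` (best sample
  `≤ CVaR_α`) and `sampleCVaR_le_mean` (`CVaR_α ≤` sample mean);
* `prop51_mean_eq_one`, `prop51_halfTail_eq` — the arithmetic of the printed two-qubit
  example: outcome probabilities `(cos²(θ/2)/2, sin²(θ/2)/2, sin²(θ/2)/2, cos²(θ/2)/2)` on the
  values `(0, 1, 1, 2)` have mean `1`, and the lower half of the distribution (mass
  `cos²(θ/2)/2` on the value `0` plus mass `sin²(θ/2)/2` on the value `1`, which is exactly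
  `1/2`) has mean `sin²(θ/2)`.

NOT here: the distributional functional `𝔼[X | X ≤ F_X⁻¹(α)]` for general laws (the
example is done by the explicit lower-tail split the paper's "doing the calculations" refers
to), the `O(1/(Kα²))` estimator-variance remark (cited there to Hong 2011), and anything about
optimizer behaviour or the experiments.  No named facts, no `sorry`.
-/

namespace Literature.Computability.QuantumAlgorithms

open Finset Real

namespace CVaR

/-! ## §1 The printed sample objective -/

/-- The number of retained samples `⌈αK⌉` of [cite: BarkoutsosEtAl2020, §4, display (CVaR_α
of a set of samples)]. -/
noncomputable def tailCount (α : ℝ) (K : ℕ) : ℕ := ⌈α * K⌉₊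

/-- The mean of the `m` smallest samples `(1/m) ∑_{k<m} H_k` of a sequence sorted in
nondecreasing order (indices from `0`). [cite: BarkoutsosEtAl2020, §4] -/
noncomputable def lowerTailMean (H : ℕ → ℝ) (m : ℕ) : ℝ := (∑ k ∈ range m, H k) / m

/-- **The sample `CVaR_α`** of `K` samples sorted in nondecreasing order:
`(1/⌈αK⌉) ∑_{k<⌈αK⌉} H_k`. [cite: BarkoutsosEtAl2020, §4, display] -/
noncomputable def sampleCVaR (H : ℕ → ℝ) (K : ℕ) (α : ℝ) : ℝ := lowerTailMean H (tailCount α K)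

/-- Unfolding: `CVaR_α = (1/⌈αK⌉) ∑_{k<⌈αK⌉} H_k`. [cite: BarkoutsosEtAl2020, §4, display] -/
theorem sampleCVaR_eq (H : ℕ → ℝ) (K : ℕ) (α : ℝ) :
    sampleCVaR H K α = (∑ k ∈ range ⌈α * K⌉₊, H k) / ⌈α * K⌉₊ := rfl

/-! ## §2 `⌈αK⌉`: the two endpoints and monotonicity -/

/-- `⌈1 · K⌉ = K`. [cite: BarkoutsosEtAl2020, §4 "α = 1 corresponds to the expected value"] -/
theorem tailCount_one (K : ℕ) : tailCount 1 K = K := by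
  simp [tailCount]

/-- For `0 < αK ≤ 1` exactly one sample is retained. [cite: BarkoutsosEtAl2020, §4 "the limit
α ↘ 0 corresponds to the minimum"] -/
theorem tailCount_eq_one {α : ℝ} {K : ℕ} (hpos : 0 < α * K) (hle : α * K ≤ 1) :
    tailCount α K = 1 := by
  unfold tailCount
  rw [Nat.ceil_eq_iff one_ne_zero]
  exact ⟨by simpa using hpos, by simpa using hle⟩

/-- `⌈αK⌉ ≤ K` for `α ≤ 1`. [folklore] -/
private theorem tailCount_le {α : ℝ} (hα : α ≤ 1) (K : ℕ) : tailCount α K ≤ K := by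
  unfold tailCount
  have h : α * K ≤ (K : ℝ) := by
    have hK : (0 : ℝ) ≤ K := Nat.cast_nonneg K
    nlinarith
  calc ⌈α * (K : ℝ)⌉₊ ≤ ⌈((K : ℕ) : ℝ)⌉₊ := Nat.ceil_mono h
    _ = K := Nat.ceil_natCast K

/-- At least one sample is retained as soon as `0 < α` and `0 < K`. [folklore] -/
private theorem one_le_tailCount {α : ℝ} (hα : 0 < α) {K : ℕ} (hK : 0 < K) : 1 ≤ tailCount α K := by
  unfold tailCount
  have h : 0 < α * K := mul_pos hα (by exact_mod_cast hK)
  rw [Nat.one_le_iff_ne_zero]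
  intro h0
  rw [Nat.ceil_eq_zero] at h0
  linarith

/-- `⌈αK⌉` is nondecreasing in `α`. [folklore] -/
private theorem tailCount_mono {α β : ℝ} (h : α ≤ β) (K : ℕ) : tailCount α K ≤ tailCount β K := by
  unfold tailCount
  exact Nat.ceil_mono (mul_le_mul_of_nonneg_right h (Nat.cast_nonneg K))

/-! ## §3 The lower-tail mean of a sorted sequence -/

/-- `(1/1) ∑_{k<1} H_k = H_0`. [folklore] -/
private theorem lowerTailMean_one (H : ℕ → ℝ) : lowerTailMean H 1 = H 0 := by
  simp [lowerTailMean]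

/-- For a sequence sorted in nondecreasing order up to index `m`, the first `m` samples sum to
at most `m · H_m`. [folklore] -/
private theorem sum_range_le_mul_of_sorted {H : ℕ → ℝ} {m : ℕ} (hsort : ∀ k < m, H k ≤ H m) :
    ∑ k ∈ range m, H k ≤ m * H m := by
  calc ∑ k ∈ range m, H k ≤ ∑ _k ∈ range m, H m :=
        sum_le_sum fun k hk => hsort k (mem_range.mp hk)
    _ = m * H m := by simp

/-- One more retained sample cannot decrease the lower-tail mean of a sorted sequence:
`(1/m) ∑_{k<m} H_k ≤ (1/(m+1)) ∑_{k<m+1} H_k`. [folklore] -/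
private theorem lowerTailMean_le_succ {H : ℕ → ℝ} {m : ℕ} (hm : 0 < m) (hsort : ∀ k < m, H k ≤ H m) :
    lowerTailMean H m ≤ lowerTailMean H (m + 1) := by
  unfold lowerTailMean
  have hS := sum_range_le_mul_of_sorted hsort
  have hm' : (0 : ℝ) < m := by exact_mod_cast hm
  rw [sum_range_succ, div_le_div_iff₀ hm' (by positivity)]
  push_cast
  nlinarith

/-- **Monotonicity in the number of retained samples**: for `1 ≤ m ≤ m'` and a sequence sorted
in nondecreasing order on the indices `< m'`, the mean of the `m` smallest samples is at most
the mean of the `m'` smallest. [folklore] -/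
private theorem lowerTailMean_mono {H : ℕ → ℝ} {m m' : ℕ} (hm : 1 ≤ m) (hmm' : m ≤ m')
    (hsort : ∀ i j, i ≤ j → j < m' → H i ≤ H j) :
    lowerTailMean H m ≤ lowerTailMean H m' := by
  induction m' with
  | zero => omega
  | succ n ih =>
    rcases Nat.eq_or_lt_of_le hmm' with h | h
    · rw [h]
    · have hmn : m ≤ n := Nat.lt_succ_iff.mp h
      have h1 : lowerTailMean H m ≤ lowerTailMean H n :=
        ih hmn fun i j hij hj => hsort i j hij (Nat.lt_succ_of_lt hj)
      have h2 : lowerTailMean H n ≤ lowerTailMean H (n + 1) :=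
        lowerTailMean_le_succ (by omega) fun k hk => hsort k n hk.le (Nat.lt_succ_self n)
      exact h1.trans h2

/-- The first sample of a sorted sequence is below every lower-tail mean. [folklore] -/
private theorem head_le_lowerTailMean {H : ℕ → ℝ} {m : ℕ} (hm : 1 ≤ m)
    (hsort : ∀ i j, i ≤ j → j < m → H i ≤ H j) : H 0 ≤ lowerTailMean H m := by
  rw [← lowerTailMean_one H]
  exact lowerTailMean_mono le_rfl hm hsort

/-! ## §4 The printed statements about `CVaR_α` -/

/-- **"`α = 1` corresponds to the expected value of `X`"** — at `α = 1` the objective is the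
sample mean `(1/K) ∑_{k<K} H_k`. [cite: BarkoutsosEtAl2020, §4] -/
theorem sampleCVaR_one (H : ℕ → ℝ) (K : ℕ) :
    sampleCVaR H K 1 = (∑ k ∈ range K, H k) / K := by
  simp [sampleCVaR, lowerTailMean, tailCount_one]

/-- **"The limit `α ↘ 0` corresponds to the minimum"** — as soon as `0 < αK ≤ 1` the objective
equals the first (smallest) sample. [cite: BarkoutsosEtAl2020, §4] -/
theorem sampleCVaR_eq_head (H : ℕ → ℝ) {K : ℕ} {α : ℝ} (hpos : 0 < α * K) (hle : α * K ≤ 1) :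
    sampleCVaR H K α = H 0 := by
  rw [sampleCVaR, tailCount_eq_one hpos hle, lowerTailMean_one]

/-- For samples "sorted in nondecreasing order" the first sample IS `min {H_1, …, H_K}`.
[cite: BarkoutsosEtAl2020, §4] -/
theorem head_le_sample {H : ℕ → ℝ} {K : ℕ} (hsort : ∀ i j, i ≤ j → j < K → H i ≤ H j)
    {k : ℕ} (hk : k < K) : H 0 ≤ H k :=
  hsort 0 k (Nat.zero_le k) hk

/-- Consequence proved here (not a printed display): **`CVaR_α` is nondecreasing in `α`** on
`(0, 1]` for sorted samples — the interpolation "between the sample mean and the best observed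
sample" of [cite: BarkoutsosEtAl2020, §4 ("CVaR is a generalization of both the sample mean
and the best observed sample"; "for small, nonzero values of α, CVaR still puts emphasis on
the best observed samples")]. -/
theorem sampleCVaR_mono {H : ℕ → ℝ} {K : ℕ} (hK : 0 < K)
    (hsort : ∀ i j, i ≤ j → j < K → H i ≤ H j) {α β : ℝ} (hα : 0 < α) (hαβ : α ≤ β)
    (hβ : β ≤ 1) : sampleCVaR H K α ≤ sampleCVaR H K β := by
  unfold sampleCVaR
  have hβK := tailCount_le hβ K
  exact lowerTailMean_mono (one_le_tailCount hα hK) (tailCount_mono hαβ K)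
    fun i j hij hj => hsort i j hij (lt_of_lt_of_le hj hβK)

/-- Consequence proved here (not a printed display): the best observed sample is a lower
bound, `min_k H_k = H_0 ≤ CVaR_α`. [cite: BarkoutsosEtAl2020, §4 ("a generalization of both
the sample mean and the best observed sample")] -/
theorem head_le_sampleCVaR {H : ℕ → ℝ} {K : ℕ} (hK : 0 < K)
    (hsort : ∀ i j, i ≤ j → j < K → H i ≤ H j) {α : ℝ} (hα : 0 < α) (hα1 : α ≤ 1) :
    H 0 ≤ sampleCVaR H K α := by
  unfold sampleCVaR
  exact head_le_lowerTailMean (one_le_tailCount hα hK)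
    fun i j hij hj => hsort i j hij (lt_of_lt_of_le hj (tailCount_le hα1 K))

/-- Consequence proved here (not a printed display): the sample mean is an upper bound,
`CVaR_α ≤ CVaR_1 = (1/K) ∑_k H_k`. [cite: BarkoutsosEtAl2020, §4 ("a generalization of both
the sample mean and the best observed sample")] -/
theorem sampleCVaR_le_mean {H : ℕ → ℝ} {K : ℕ} (hK : 0 < K)
    (hsort : ∀ i j, i ≤ j → j < K → H i ≤ H j) {α : ℝ} (hα : 0 < α) (hα1 : α ≤ 1) :
    sampleCVaR H K α ≤ (∑ k ∈ range K, H k) / K := by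
  rw [← sampleCVaR_one H K]
  exact sampleCVaR_mono hK hsort hα hα1 le_rfl

/-! ## §5 The two-qubit example in the proof of Proposition 5.1 -/

/-- The printed example: with outcome probabilities `|⟨j|ψ(θ)⟩|²` equal to
`cos²(θ/2)/2, sin²(θ/2)/2, sin²(θ/2)/2, cos²(θ/2)/2` on the diagonal values `0, 1, 1, 2` of
`H = diag(0,1,1,2)`, the expected value is `1` "independent of `θ`".
[cite: BarkoutsosEtAl2020, §5, proof of Proposition 5.1] -/
theorem prop51_mean_eq_one (θ : ℝ) :
    0 * (cos (θ / 2) ^ 2 / 2) + 1 * (sin (θ / 2) ^ 2 / 2) + 1 * (sin (θ / 2) ^ 2 / 2)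
      + 2 * (cos (θ / 2) ^ 2 / 2) = 1 := by
  nlinarith [sin_sq_add_cos_sq (θ / 2)]

/-- The four outcome probabilities of the example sum to one. [cite: BarkoutsosEtAl2020, §5,
proof of Proposition 5.1] -/
theorem prop51_probs_sum (θ : ℝ) :
    cos (θ / 2) ^ 2 / 2 + sin (θ / 2) ^ 2 / 2 + sin (θ / 2) ^ 2 / 2 + cos (θ / 2) ^ 2 / 2
      = 1 := by
  nlinarith [sin_sq_add_cos_sq (θ / 2)]

/-- The lower half of the example's distribution: the whole atom at the value `0` (mass
`cos²(θ/2)/2 ≤ 1/2`) together with mass `sin²(θ/2)/2` taken from the value-`1` atoms fills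
exactly the mass `α = 1/2`. [cite: BarkoutsosEtAl2020, §5, proof of Proposition 5.1
("doing the calculations")] -/
theorem prop51_halfTail_mass (θ : ℝ) :
    cos (θ / 2) ^ 2 / 2 ≤ 1 / 2 ∧ sin (θ / 2) ^ 2 / 2 ≤ sin (θ / 2) ^ 2 / 2 + sin (θ / 2) ^ 2 / 2
      ∧ cos (θ / 2) ^ 2 / 2 + sin (θ / 2) ^ 2 / 2 = 1 / 2 := by
  refine ⟨?_, ?_, ?_⟩
  · nlinarith [cos_sq_le_one (θ / 2)]
  · nlinarith [sq_nonneg (sin (θ / 2))]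
  · nlinarith [sin_sq_add_cos_sq (θ / 2)]

/-- **"`CVaR_{0.5}(X(θ)) = sin²(θ/2)`"**: the mean of that lower half,
`(0 · cos²(θ/2)/2 + 1 · sin²(θ/2)/2) / (1/2)`, equals `sin²(θ/2)`.
[cite: BarkoutsosEtAl2020, §5, proof of Proposition 5.1] -/
theorem prop51_halfTail_eq (θ : ℝ) :
    (0 * (cos (θ / 2) ^ 2 / 2) + 1 * (sin (θ / 2) ^ 2 / 2)) / (1 / 2) = sin (θ / 2) ^ 2 := by
  ring

/-- Hence, in the example, the `α = 1/2` objective is strictly below the (constant) mean `1`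
whenever `sin²(θ/2) < 1`, e.g. at `θ = 0` where it equals `0` — "the only local minima are at
`θ = 2kπ`". [cite: BarkoutsosEtAl2020, §5, proof of Proposition 5.1] -/
theorem prop51_halfTail_at_zero : sin ((0 : ℝ) / 2) ^ 2 = 0 := by
  simp

end CVaR

end Literature.Computability.QuantumAlgorithms
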